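import Literature.MathematicalPhysics.QuantumFieldTheory.Balaban1983to89.B12Membership314

/-!
# NODE 00 — the algebra behind [6]'s BASIC ESTIMATE (1.54) for the CO-DIVERGENCE at the trivial background: transported differences of
# ordered exponential products (`Beta.TransportVertices.holonomy`) are the difference of their LINEAR terms up to a cubic error

Cell `pub-ymgap`, seat `pub-ymgap-dag-n07-e` generation 13 (R141 (C), DAG node N07 = [15]; cell INBOX INTENT-33 of 2026-08-27).  NEW leaf, PROOF kind (no `def`);
pub-balaban's `Beta.TransportVertices` (`holonomy`, `quad`, `size`, `expTail`, the Taylor bounds `norm_holonomy_sub_taylor_one_le` ∕ `…two_le`) and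
`B12Membership314` (`norm_mul_exp_le`) CONSUMED BY NAME, nothing modified.  `--supports stmt-QuantumFields-20541` (K0⁷).  Companion files (same INTENT):
`Node00.LocalGaugeCoDivergenceLetters` (print's `∂^ξA`, `∂^{ξ*}∂^ξA` letters and the clause `Sect2.LocalGauge10On`) and `Node00.LocalGaugeCoDivergence` (the estimate
at NODE 00's objects).  [6] = [Balaban1985RegularSpaces]; [15] = [Balaban1985Variational]; B9 = [Balaban1985BackgroundPropagators].

WHY.  [15] Sect. F closes Prop. 8 with (168) p. 304: *«This [(167): |A|, |∇^ηA|, |∂^{η*}∂^ηA|, |Δ^ηA| < ε′·(L^jη)^{−1,−2,−3,−3}] and the inequality (1.54) of [6] imply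
|U₁(∂p) − 1| < ε′ + 86dε′² < 2ε′ on Δ₀ (168) for ε′ small, similarly for |D^{η*}∂U₁|»* — the SECOND clause is the (1.9)-member of the class (2), and behind it is
[6]'s basic estimate (1.54) p. 85, `η·D^{η*}_{U₀}∂(U₁U₀) = η·D^{η*}_{U₀}∂U₀ + iη²·D^{η*}_{U₀}D^η_{U₀}A + O(d·α₂·(|A| + |∇A|)·η²)` (there with a background `U₀`; [6]
Sect. G Prop. 7 p. 100 reads it as (1.140) ⇒ (1.142)).  Module 31 (`Node00.LocalGaugePlaquette`) kernel-checked the plaquette clause from `B12Membership314`'s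
FIRST-order expansion.  The co-divergence is a DIFFERENCE of neighbouring plaquette variables, one of them parallel-transported: its linear part is `iξ³·∂^{ξ*}∂^ξA`,
and the estimate needs (a) the SECOND-order transport vertex `quad` of `Beta.TransportVertices` to be LIPSCHITZ in the letters (so that the `O(ξ²t²)` commutator
terms of two neighbouring plaquettes cancel to `O(ξ³t²)`), (b) the conjugation by the transporting bond variable to cost only `O(ξt)·‖∂U − 1‖`, (c) the cubic Taylor
tails.  This file supplies exactly these three generic pieces and the real-arithmetic budget that closes them at `32·ξ³t²` under `0 < ξ ≤ 1`, `32t ≤ 1`.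

CONTENTS (any complete normed ℂ-algebra `𝔸`; no commutativity, no `‖1‖ = 1`).  §1 `norm_exp_neg_mul_mul_exp_sub_le` (`‖e^{−c}Xe^{c} − X‖ ≤ ‖X‖(e^{2‖c‖} − 1)`),
`norm_sum_sub_sum_le_of_forall₂` (`‖Σl′ − Σl‖ ≤ n·δ`), ★ `norm_quad_sub_quad_le_of_forall₂` (`‖quad l′ − quad l‖ ≤ n²·a·δ` for letters of size `≤ a` differing by `≤ δ`),
★ `norm_transport_holonomy_sub_linear_le` (`‖[e^{−c}(hol l′ − 1)e^{c} − (hol l − 1)] − (Σl′ − Σl)‖ ≤ ‖hol l′ − 1‖(e^{2‖c‖} − 1) + ‖quad l′ − quad l‖ + T₃(size l′) + T₃(size l)`),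
`norm_holonomy_sub_one_le_sum_add` (`‖hol l − 1‖ ≤ ‖Σl‖ + T₂(size l)`), `norm_sum_le_of_termwise` (a finite sum is within `card·C` of a termwise `C`-close sum).
§2 `coDivBudget`: with `n = 4` letters of size `ξt`, differences `ξ²t`, transport letter `≤ ξt`, linear sum `≤ 2ξ²t`: the three errors total `≤ 32·ξ³·t²`
(`0 < ξ ≤ 1`, `0 ≤ t`, `32t ≤ 1`; crude bounds `e^x ≤ 1 + 2x` on `[0,1]`).

HONEST FRAMING: elementary Banach-algebra inequalities and one real-arithmetic budget [folklore]; NOTHING of Bałaban's analysis asserted or proved; K0⁷ ∕ V15 stub 1 NOT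
closed; N07 NOT discharged; counts unmoved (5∕27); one finite T⁴ programme at fixed ε — NOT continuum ∕ ℝ⁴ ∕ OS ∕ mass gap ∕ Clay.  No `sorry`, no `def`, no
`instance`, no `notation`.
-/

noncomputable section

namespace Literature.MathematicalPhysics.QuantumFieldTheory.Balaban1983to89.Node00

open NormedSpace
open Beta.TransportVertices

/-! ## §1  Transported differences of ordered exponential products -/

section Algebra

variable {𝔸 : Type*} [NormedRing 𝔸] [NormedAlgebra ℂ 𝔸] [CompleteSpace 𝔸]

/-- **Conjugation by a near-identity exponential costs `O(‖c‖)·‖X‖`**: `‖e^{−c}·X·e^{c} − X‖ ≤ ‖X‖·(e^{2‖c‖} − 1)` (write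
`e^{−c}Xe^{c} − X = (e^{−c} − 1)·(Xe^{c}) + X·(e^{c} − 1)`; no `‖1‖ = 1`).  The parallel transport `R(U(x, x−e_ν))` of [6] (1.1) applied to a plaquette
variable minus one (elementary estimate, proof ours). [cite: Balaban1985RegularSpaces, (1.1)–(1.2) p.76, (1.54) p.85] -/
theorem norm_exp_neg_mul_mul_exp_sub_le (c X : 𝔸) :
    ‖exp (-c) * X * exp c - X‖ ≤ ‖X‖ * (Real.exp ‖c‖ ^ 2 - 1) := by
  have h : exp (-c) * X * exp c - X = (exp (-c) - 1) * (X * exp c) + X * (exp c - 1) := by noncomm_ring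
  have h1 : ‖exp (-c) - 1‖ ≤ Real.exp ‖c‖ - 1 := by
    simpa [norm_neg] using norm_exp_sub_one_le_expTail ℂ (-c)
  have h2 : ‖exp c - 1‖ ≤ Real.exp ‖c‖ - 1 := by simpa using norm_exp_sub_one_le_expTail ℂ c
  have h3 : ‖X * exp c‖ ≤ ‖X‖ * Real.exp ‖c‖ := B12Membership314.norm_mul_exp_le X c
  have h0 : 0 ≤ Real.exp ‖c‖ - 1 := by linarith [Real.add_one_le_exp ‖c‖, norm_nonneg c]
  rw [h]
  calc ‖(exp (-c) - 1) * (X * exp c) + X * (exp c - 1)‖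
      ≤ ‖exp (-c) - 1‖ * ‖X * exp c‖ + ‖X‖ * ‖exp c - 1‖ :=
        (norm_add_le _ _).trans (add_le_add (norm_mul_le _ _) (norm_mul_le _ _))
    _ ≤ (Real.exp ‖c‖ - 1) * (‖X‖ * Real.exp ‖c‖) + ‖X‖ * (Real.exp ‖c‖ - 1) := by gcongr
    _ = ‖X‖ * (Real.exp ‖c‖ ^ 2 - 1) := by ring

omit [NormedAlgebra ℂ 𝔸] [CompleteSpace 𝔸] in
/-- **The linear transport vertex is Lipschitz in the letters**: if the letters of `l′` differ from those of `l` by at most `δ` each, `‖Σl′ − Σl‖ ≤ n·δ` (the linear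
vertex `Σ_j b_j` of B9 (3.6); elementary, proof ours). [cite: Balaban1985BackgroundPropagators, (3.4)–(3.6) p.391] -/
theorem norm_sum_sub_sum_le_of_forall₂ {δ : ℝ} {l l' : List 𝔸} (h : List.Forall₂ (fun b b' => ‖b' - b‖ ≤ δ) l l') :
    ‖l'.sum - l.sum‖ ≤ l.length * δ := by
  induction h with
  | nil => simp
  | @cons b b' m m' hb _ ih =>
    rw [List.sum_cons, List.sum_cons, List.length_cons, Nat.cast_succ,
      show b' + m'.sum - (b + m.sum) = (b' - b) + (m'.sum - m.sum) by abel]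
    refine (norm_add_le _ _).trans ?_
    linarith

omit [CompleteSpace 𝔸] in
/-- ★ **The quadratic transport vertex is Lipschitz in the letters**: for two lists of the same length `n` with letters of size `≤ a` differing termwise by `≤ δ`,
`‖quad l′ − quad l‖ ≤ n²·a·δ` (`quad (b :: l) = quad l + b·Σl + ½b²`: the step costs `(2|l| + 1)·a·δ`).  This is what makes the `O(ξ²t²)` commutator terms of two
NEIGHBOURING plaquettes (B9 (3.6)'s `Σ_{b₁≺b₂}[A′(b₁), A′(b₂)]`, [6] (1.49)–(1.52)) cancel to `O(ξ³t²)` in the co-divergence (proof ours).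
[cite: Balaban1985RegularSpaces, (1.49)–(1.52) p.85; Balaban1985BackgroundPropagators, (3.6) p.391] -/
theorem norm_quad_sub_quad_le_of_forall₂ {a δ : ℝ} (ha0 : 0 ≤ a) (hδ0 : 0 ≤ δ) {l l' : List 𝔸}
    (h : List.Forall₂ (fun b b' => ‖b' - b‖ ≤ δ) l l') (ha : ∀ b ∈ l, ‖b‖ ≤ a) (ha' : ∀ b ∈ l', ‖b‖ ≤ a) :
    ‖quad ℂ l' - quad ℂ l‖ ≤ (l.length : ℝ) ^ 2 * a * δ := by
  induction h with
  | nil => simp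
  | @cons b b' m m' hb hmm' ih =>
    have hbm : ‖b‖ ≤ a := ha b (by simp)
    have hbm' : ‖b'‖ ≤ a := ha' b' (by simp)
    have ihm := ih (fun c hc => ha c (by simp [hc])) (fun c hc => ha' c (by simp [hc]))
    have hlen : m'.length = m.length := hmm'.length_eq.symm
    have hS : ‖m'.sum‖ ≤ m.length * a := by
      rw [← hlen]
      exact (norm_sum_le_size m').trans (size_le_length_mul m' fun c hc => ha' c (by simp [hc]))
    have hD : ‖m'.sum - m.sum‖ ≤ m.length * δ := norm_sum_sub_sum_le_of_forall₂ hmm'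
    have hmid : (b' - b) * m'.sum + b * (m'.sum - m.sum) = b' * m'.sum - b * m.sum := by noncomm_ring
    have hsq : (2 : ℂ)⁻¹ • ((b' - b) * b' + b * (b' - b)) = (2 : ℂ)⁻¹ • (b' * b') - (2 : ℂ)⁻¹ • (b * b) := by
      rw [← smul_sub]; congr 1; noncomm_ring
    have key : quad ℂ m' + b' * m'.sum + (2 : ℂ)⁻¹ • (b' * b') - (quad ℂ m + b * m.sum + (2 : ℂ)⁻¹ • (b * b)) =
        (quad ℂ m' - quad ℂ m) + ((b' - b) * m'.sum + b * (m'.sum - m.sum)) + (2 : ℂ)⁻¹ • ((b' - b) * b' + b * (b' - b)) := by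
      rw [hmid, hsq]; abel
    rw [quad_cons, quad_cons, List.length_cons, Nat.cast_succ, key]
    have h2 : ‖(2 : ℂ)⁻¹ • ((b' - b) * b' + b * (b' - b))‖ ≤ 2⁻¹ * (δ * a + a * δ) := by
      rw [norm_smul, norm_inv, RCLike.norm_ofNat]
      gcongr
      exact (norm_add_le _ _).trans (add_le_add ((norm_mul_le _ _).trans (by gcongr)) ((norm_mul_le _ _).trans (by gcongr)))
    have h1 : ‖(b' - b) * m'.sum + b * (m'.sum - m.sum)‖ ≤ δ * (m.length * a) + a * (m.length * δ) :=
      (norm_add_le _ _).trans (add_le_add ((norm_mul_le _ _).trans (by gcongr)) ((norm_mul_le _ _).trans (by gcongr)))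
    calc ‖quad ℂ m' - quad ℂ m + ((b' - b) * m'.sum + b * (m'.sum - m.sum)) + (2 : ℂ)⁻¹ • ((b' - b) * b' + b * (b' - b))‖
        ≤ (m.length : ℝ) ^ 2 * a * δ + (δ * (m.length * a) + a * (m.length * δ)) + 2⁻¹ * (δ * a + a * δ) :=
          (norm_add₃_le).trans (add_le_add_three ihm h1 h2)
      _ = ((m.length : ℝ) + 1) ^ 2 * a * δ := by ring

/-- ★ **A TRANSPORTED DIFFERENCE OF ORDERED EXPONENTIAL PRODUCTS IS THE DIFFERENCE OF THE LINEAR VERTICES UP TO THREE ERRORS**: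
`‖[e^{−c}(hol l′ − 1)e^{c} − (hol l − 1)] − (Σl′ − Σl)‖ ≤ ‖hol l′ − 1‖·(e^{2‖c‖} − 1) + ‖quad l′ − quad l‖ + (T₃(size l′) + T₃(size l))`, `T₃ = expTail 3`
(write `hol = 1 + Σ + quad + R₃` for both products, `Beta.TransportVertices.norm_holonomy_sub_taylor_two_le` BY NAME for `R₃`, §1's conjugation bound for the
transport).  The shape of [6] (1.54): co-divergence of `∂(e^{iξA})` = linear term `iξ³∂^{ξ*}∂^ξA` + errors (statement skeleton of the printed estimate at the
trivial background; proof ours). [cite: Balaban1985RegularSpaces, (1.48)–(1.54) p.85; Balaban1985BackgroundPropagators, (3.6) p.391] -/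
theorem norm_transport_holonomy_sub_linear_le (c : 𝔸) (l l' : List 𝔸) :
    ‖(exp (-c) * (holonomy l' - 1) * exp c - (holonomy l - 1)) - (l'.sum - l.sum)‖ ≤
      ‖holonomy l' - 1‖ * (Real.exp ‖c‖ ^ 2 - 1) + ‖quad ℂ l' - quad ℂ l‖ + (expTail 3 (size l') + expTail 3 (size l)) := by
  set H' := holonomy l' - 1
  set H := holonomy l - 1
  have hsplit : (exp (-c) * H' * exp c - H) - (l'.sum - l.sum) =
      (exp (-c) * H' * exp c - H') + (quad ℂ l' - quad ℂ l) + ((H' - l'.sum - quad ℂ l') - (H - l.sum - quad ℂ l)) := by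
    abel
  rw [hsplit]
  refine (norm_add₃_le).trans (add_le_add_three (norm_exp_neg_mul_mul_exp_sub_le c H') le_rfl ?_)
  exact (norm_sub_le _ _).trans (add_le_add (norm_holonomy_sub_taylor_two_le ℂ l') (norm_holonomy_sub_taylor_two_le ℂ l))

/-- The deviation of an ordered exponential product from `1` through its linear vertex: `‖hol l − 1‖ ≤ ‖Σl‖ + T₂(size l)` (`Beta.TransportVertices.norm_holonomy_sub_taylor_one_le`
BY NAME) — used with `‖Σl‖ = O(ξ²t)` (the letter sum of a plaquette is `iξ²` times the lattice curl, B9 (3.4)∕(3.6)), sharper than `e^{size} − 1 = O(ξt)`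
(elementary, proof ours). [cite: Balaban1985BackgroundPropagators, (3.6) p.391] -/
theorem norm_holonomy_sub_one_le_sum_add (l : List 𝔸) : ‖holonomy l - 1‖ ≤ ‖l.sum‖ + expTail 2 (size l) := by
  have h : holonomy l - 1 = l.sum + (holonomy l - 1 - l.sum) := by abel
  rw [h]
  exact (norm_add_le _ _).trans (add_le_add le_rfl (norm_holonomy_sub_taylor_one_le ℂ l))

end Algebra

section Sums

/-- A finite sum is within `card·C` of another whose terms are `C`-close: `‖Σf‖ ≤ ‖Σg‖ + |ι|·C` if `‖f i − g i‖ ≤ C` — the sum over directions `ν` in [6] (1.2)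
(elementary bookkeeping, proof ours). [cite: Balaban1985RegularSpaces, (1.2) p.76] -/
theorem norm_sum_le_of_termwise {ι E : Type*} [Fintype ι] [SeminormedAddCommGroup E] (f g : ι → E) {C : ℝ}
    (h : ∀ i, ‖f i - g i‖ ≤ C) : ‖∑ i, f i‖ ≤ ‖∑ i, g i‖ + Fintype.card ι * C := by
  have hs : ∑ i, f i = ∑ i, g i + ∑ i, (f i - g i) := by
    rw [← Finset.sum_add_distrib]; exact Finset.sum_congr rfl fun i _ => by abel
  rw [hs]
  refine (norm_add_le _ _).trans (add_le_add le_rfl ?_)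
  calc ‖∑ i, (f i - g i)‖ ≤ ∑ i, ‖f i - g i‖ := norm_sum_le _ _
    _ ≤ ∑ _i : ι, C := Finset.sum_le_sum fun i _ => h i
    _ = Fintype.card ι * C := by simp [Finset.sum_const, Finset.card_univ, nsmul_eq_mul]

end Sums

/-! ## §2  The real-arithmetic budget: four letters of size `ξt`, differences `ξ²t`, transport letter `ξt`, linear sum `2ξ²t` ⇒ total error `≤ 32·ξ³·t²` -/

section Budget

/-- **The budget behind the co-divergence estimate** (`0 < ξ ≤ 1`, `0 ≤ t`, `32t ≤ 1`): the transport error `(2ξ²t + T₂-bound at size 4ξt)·(e^{2ξt} − 1)`, the quadratic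
vertex error `4²·(ξt)·(ξ²t)` and the two cubic tails `2·((4ξt)³/6)e^{4ξt}` total at most `32·ξ³·t²` (via `e^{x} ≤ 1 + 2x` on `[0, 1]`; the bracket closes at
`≈ 26.1·ξ³t²`).  Print's constant in (168) ∕ (1.142) is absorbed differently («ε′ + 86dε′² < 2ε′», «α₀ + 3α₂»); no optimality claimed (arithmetic ours).
[cite: Balaban1985Variational, (168) p.304; Balaban1985RegularSpaces, (1.142) p.100] -/
theorem coDivBudget {ξ t : ℝ} (hξ : 0 < ξ) (hξ1 : ξ ≤ 1) (ht : 0 ≤ t) (ht1 : 32 * t ≤ 1) :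
    (2 * ξ ^ 2 * t + (4 * (ξ * t)) ^ 2 / 2 * Real.exp (4 * (ξ * t))) * (Real.exp (ξ * t) ^ 2 - 1) +
        (4 : ℝ) ^ 2 * (ξ * t) * (ξ ^ 2 * t) + 2 * ((4 * (ξ * t)) ^ 3 / 6 * Real.exp (4 * (ξ * t))) ≤
      32 * ξ ^ 3 * t ^ 2 := by
  have hu0 : 0 ≤ ξ * t := mul_nonneg hξ.le ht
  have hu32 : 32 * (ξ * t) ≤ 1 := by nlinarith
  have he4 : Real.exp (4 * (ξ * t)) ≤ 5 / 4 := by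
    have h := Real.abs_exp_sub_one_le (x := 4 * (ξ * t)) (by rw [abs_of_nonneg (by positivity)]; linarith)
    rw [abs_of_nonneg (show (0 : ℝ) ≤ 4 * (ξ * t) by positivity)] at h
    linarith [(abs_le.mp h).2]
  have he2 : Real.exp (ξ * t) ^ 2 - 1 ≤ 4 * (ξ * t) := by
    rw [← Real.exp_nat_mul, Nat.cast_ofNat]
    have h := Real.abs_exp_sub_one_le (x := 2 * (ξ * t)) (by rw [abs_of_nonneg (by positivity)]; linarith)
    rw [abs_of_nonneg (show (0 : ℝ) ≤ 2 * (ξ * t) by positivity)] at h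
    linarith [(abs_le.mp h).2]
  have he2' : 0 ≤ Real.exp (ξ * t) ^ 2 - 1 := by nlinarith [Real.one_le_exp hu0]
  have hE4 : 0 ≤ Real.exp (4 * (ξ * t)) := (Real.exp_pos _).le
  have hF : 2 * ξ ^ 2 * t + (4 * (ξ * t)) ^ 2 / 2 * Real.exp (4 * (ξ * t)) ≤ 2 * ξ ^ 2 * t + 10 * (ξ ^ 2 * t ^ 2) := by
    nlinarith
  have hF0 : 0 ≤ 2 * ξ ^ 2 * t + (4 * (ξ * t)) ^ 2 / 2 * Real.exp (4 * (ξ * t)) := by positivity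
  have hFE : (2 * ξ ^ 2 * t + (4 * (ξ * t)) ^ 2 / 2 * Real.exp (4 * (ξ * t))) * (Real.exp (ξ * t) ^ 2 - 1) ≤
      (2 * ξ ^ 2 * t + 10 * (ξ ^ 2 * t ^ 2)) * (4 * (ξ * t)) :=
    mul_le_mul hF he2 he2' (by positivity)
  have hC : 2 * ((4 * (ξ * t)) ^ 3 / 6 * Real.exp (4 * (ξ * t))) ≤ 80 / 3 * (ξ ^ 3 * t ^ 3) := by
    nlinarith [pow_nonneg hu0 3]
  have h3 : ξ ^ 3 * t ^ 3 ≤ ξ ^ 3 * t ^ 2 / 32 := by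
    have : t ^ 3 ≤ t ^ 2 / 32 := by nlinarith [sq_nonneg t]
    nlinarith [pow_pos hξ 3]
  nlinarith [hFE, hC, h3, pow_pos hξ 3, sq_nonneg t]

end Budget

end Literature.MathematicalPhysics.QuantumFieldTheory.Balaban1983to89.Node00

end
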